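import Mathlib.RingTheory.DiscreteValuationRing.Basic
import Mathlib.RingTheory.AdicCompletion.Basic
import Mathlib.Algebra.MvPolynomial.PDeriv
import Mathlib.LinearAlgebra.Matrix.Determinant.Basic

/-!
# [AbsTopII] Lemma 2.1 (Positive slope version of Hensel's lemma) — polynomial special case

S. Mochizuki, *Topics in Absolute Anabelian Geometry II* (2013) [AbsTopII] §2, Lemma 2.1 p. 31
(manuscript pagination, lit key paper:url-585b8d0ad0d9).  Print: `k` a complete discretely
valued field, `A = 𝒪_k[[X₁,…,X_m]]`, `B = 𝒪_k[[Y₁,…,Y_n]]`, `φ : B → A`, `Yⱼ ↦ fⱼ(X)` a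
continuous `𝒪_k`-algebra homomorphism whose differential has rank `n` over the fraction field
of `A`; then there are `β₀ ∈ 𝒴(𝒪_k)` and `r > 0` such that for every finite extension `k'/k` the
image of `𝒳(𝒪_{k'}) → 𝒴(𝒪_{k'})` contains the ball `{β' ≡ β₀ mod π^r}`.  [IUTchI] p. 67 cites
"the method of proof of [AbsTopII], Lemma 2.1" (Newton iteration with a positive-slope, i.e.
only generically invertible, Jacobian).

Typed here as a closed named fact in the SPECIAL CASE: `fⱼ` polynomials (rather than power
series), `k' = k`, and `𝒪_k` an arbitrary complete discrete valuation ring `O` (points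
`𝒳(O) = 𝔪^m`, `𝒴(O) = 𝔪^n`; the rank condition as the non-vanishing of some `n × n` minor of the
Jacobian).  TODO(general form): power series `fⱼ ∈ O[[X]]` and variable finite extensions `k'/k`
(uniform `β₀, r`), which needs evaluation of multivariate power series at topologically
nilpotent points of `𝒪_{k'}`.
-/

namespace Literature.AnabelianGeometry.AbsoluteAnabelian

/-- [AbsTopII] Lemma 2.1 (Positive slope version of Hensel's lemma), polynomial / `k' = k` special
case: let `O` be a complete discrete valuation ring with maximal ideal `𝔪`, `f₁,…,f_n ∈
O[X₁,…,X_m]`, and suppose some `n × n` minor `det(∂fⱼ/∂X_{S(k)})` of the Jacobian is a nonzero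
polynomial.  Then there exist `β₀ ∈ 𝔪^n` (i.e. each coordinate in `𝔪`) and `r > 0` such that every
`β' ∈ O^n` with `β' ≡ β₀ (mod 𝔪^r)` coordinatewise is of the form `(fⱼ(x))ⱼ` for some `x ∈ 𝔪^m`.
[cite: MochizukiAbsTopII2013, Lemma 2.1 p.31] -/
def positiveSlopeHensel_polynomial : Prop :=
  ∀ (O : Type) [CommRing O] [IsDomain O] [IsDiscreteValuationRing O]
    [IsAdicComplete (IsLocalRing.maximalIdeal O) O] (m n : ℕ) (f : Fin n → MvPolynomial (Fin m) O),
    (∃ S : Fin n ↪ Fin m,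
        (Matrix.of fun j k : Fin n => MvPolynomial.pderiv (S k) (f j)).det ≠ 0) →
      ∃ (β₀ : Fin n → O) (r : ℕ), (∀ j, β₀ j ∈ IsLocalRing.maximalIdeal O) ∧ 0 < r ∧
        ∀ β' : Fin n → O, (∀ j, β' j - β₀ j ∈ IsLocalRing.maximalIdeal O ^ r) →
          ∃ x : Fin m → O, (∀ i, x i ∈ IsLocalRing.maximalIdeal O) ∧
            ∀ j, MvPolynomial.eval x (f j) = β' j

end Literature.AnabelianGeometry.AbsoluteAnabelian
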